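import Mathlib
import HarnessLib
import Literature.Probability.Percolation.HalfSpace
import Summits.CriticalPhenomena.PercolationContinuityZ3.Theses.PercTruncatedSusceptibility

/-!
# Strategist r1 — typed SECOND INVENTORY for crux `CritTruncatedSusceptibilityInfinite` (stmt-CriticalPhenomena-0850)

Companion to `Lines/necklace.md` (Appendix) and to the s2 census `STRATEGY-CENSUS.md` / `StrategistSketch.lean`.
NOT a line (no stubs). Every statement below is a `def … : Prop` over tree vocabulary; the glues that are claimed
"provable now" are PROVED here; the rest carry their status in the docstring. `lean check` rc 0, 0 sorries.

Vocabulary: `P_p = bondPercolation (zdGraph 3) p` on full-space configurations `ω : BondConfig (Site 3)`;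
`ℍ = halfSpace 3 = {x | 0 ≤ x 0}` (`HalfSpace.lean`); `0 ↔_ℍ x` = `openConnIn (halfSpace 3) 0 x` (open path using
only vertices of ℍ); `C_ℍ(0)` = the cluster of the boundary origin inside ℍ; `τ^f_p(0,x) = P_p(0 ↔ x, |C(0)| < ∞)`.

N1 (Transfer to the half-space — the exact H-analogue one level down is a THEOREM, but its complement is the summit):
* `HalfSpaceMeanInfinite`  : `Σ_x P_{p_c}(0 ↔_ℍ x) = ∞` (E_{p_c}|C_ℍ(0)| = ∞) — PROVABLE NOW (route in the docstring),
  while `C_ℍ(0)` is a.s. finite at `p_c` (BGN, `BarskyGrimmettNewman1991_Z3_holds`): "infinite mean of an a.s. finite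
  critical cluster", i.e. H's shape, holds for the half-space cluster unconditionally.
* `HalfSpacePieceSummable` (B) : `Σ_x P_{p_c}(0 ↔_ℍ x, 0 ↔ ∞) < ∞` — the complement needed to pass from `C_ℍ(0)` to the
  FINITE clusters of the full space; `H_of_halfSpace : HalfSpaceMeanInfinite → HalfSpacePieceSummable → H` PROVED below.
* but (B) `≡ S`: `halfSpacePieceSummable_of_summit` (S → (B), PROVED) and `HalfSpacePieceMTP` ((B) → S by mass transport,
  stated; M/L-sized): the transfer breaks exactly at the separating piece, which is summit-strength — costume, not a line.
N3 (Negation structure, quantitative contrapositive of line `necklace`):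
* `BridgeCountBound` : in the ¬H world, `E_{p_c}[#bridges of C(0) above 0; 0 ↔ ∞] ≤ (6p_c/(1−p_c))·Σ_x τ^f_{p_c}(0,x) < ∞`
  (deletion tolerance + mass transport; provable now, M-sized) — so ¬H forces a.s. finitely many bridges above every
  percolating vertex, i.e. a BACKBONE (¬NoBackbone): the one-edge surgery read backwards, with an explicit constant.
-/

noncomputable section

namespace Summit.CriticalPhenomena.PercolationContinuityZ3.Cruxes.CritTruncatedSusceptibilityInfinite.StrategistR1

open MeasureTheory Literature.Probability.Percolation Literature.Probability.LatticeModels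
open scoped ENNReal

/-- Shorthand (local to this sketch): the critical bond measure on `ℤ³`. [folklore] -/
abbrev Pc : Measure (BondConfig (Site 3)) := bondPercolation (zdGraph 3) (criticalProbI 3)

/-- Shorthand: the crux H, by name. [folklore] -/
abbrev H : Prop :=
  Summit.CriticalPhenomena.PercolationContinuityZ3.Theses.PercTruncatedSusceptibility.CritTruncatedSusceptibilityInfinite

/-! ## N1 — half-space transfer -/

/-- **Fact A** (PROVABLE NOW, M/L): the half-space cluster of the boundary origin has infinite mean at `p_c(ℤ³)`:
`x ↦ P_{p_c}(0 ↔_ℍ x)` is not summable. Route: (i) unfolding/BK inequality `χ(p) ≤ χ_ℍ(p)²` for `p < p_c` — split a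
self-avoiding open path `0 → x` at its vertex `v` of minimal first coordinate: the two halves are edge-disjoint open
paths inside `v + ℍ`, so `{0 ↔ x} ⊆ ⋃_v {v ↔ 0 in v+ℍ} □ {v ↔ x in v+ℍ}`, BK (`BKFinitary.lean`) and translation
invariance give `τ_p(0,x) ≤ Σ_v τ^ℍ_p(v;0) τ^ℍ_p(v;x)` and summing `χ ≤ χ_ℍ²`; (ii) `χ(p) ≥ 1/(6(p_c − p))`
(`AizenmanNewman1984_chi_lower_holds`); (iii) `P_p(0 ↔_ℍ x) ≤ P_{p_c}(0 ↔_ℍ x)` (increasing event,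
`real_mono_of_isUpperSet`); hence `Σ_x P_{p_c}(0 ↔_ℍ x) ≥ (6(p_c−p))^{-1/2}` for every `p < p_c`.
[conjecture-free; cite: GrimmettPercolation1999, §10.2 (10.41); folklore unfolding inequality] -/
def HalfSpaceMeanInfinite : Prop :=
  ¬ Summable fun x : Site 3 => Pc.real (openConnIn (halfSpace 3) (0 : Site 3) x)

/-- **(B)** the separating piece: the part of the half-space cluster of `0` lying in the INFINITE full-space cluster
has summable two-point function, `Σ_x P_{p_c}(0 ↔_ℍ x, 0 ↔ ∞) < ∞`. Trivial if `θ(p_c) = 0`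
(`halfSpacePieceSummable_of_summit`); FALSE if `θ(p_c) > 0` (`HalfSpacePieceMTP`) — hence `≡ S`. [≡ summit] -/
def HalfSpacePieceSummable : Prop :=
  Summable fun x : Site 3 => Pc.real (openConnIn (halfSpace 3) (0 : Site 3) x ∩ percolatesAt (0 : Site 3))

/-- **Glue (PROVED): Fact A ∧ (B) ⟹ H.** Pointwise `{0 ↔_ℍ x} ⊆ ({0 ↔ x} ∖ {0 ↔ ∞}) ∪ ({0 ↔_ℍ x} ∩ {0 ↔ ∞})`, so
`P(0 ↔_ℍ x) ≤ τ^f(0,x) + P(0 ↔_ℍ x, 0 ↔ ∞)`; if `τ^f` and (B) were summable, Fact A would fail. [folklore] -/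
theorem H_of_halfSpace (hA : HalfSpaceMeanInfinite) (hB : HalfSpacePieceSummable) : H := by
  intro hsum
  apply hA
  have hle : ∀ x : Site 3, Pc.real (openConnIn (halfSpace 3) (0 : Site 3) x) ≤
      Pc.real (openConn (0 : Site 3) x \ percolatesAt (0 : Site 3)) +
        Pc.real (openConnIn (halfSpace 3) (0 : Site 3) x ∩ percolatesAt (0 : Site 3)) := by
    intro x
    have hsub : openConnIn (halfSpace 3) (0 : Site 3) x ⊆
        (openConn (0 : Site 3) x \ percolatesAt (0 : Site 3)) ∪
          (openConnIn (halfSpace 3) (0 : Site 3) x ∩ percolatesAt (0 : Site 3)) := by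
      intro ω hω
      by_cases hp : ω ∈ percolatesAt (0 : Site 3)
      · exact Or.inr ⟨hω, hp⟩
      · refine Or.inl ⟨?_, hp⟩
        obtain ⟨hx, hy, hr⟩ := hω
        exact hr.map (SimpleGraph.Embedding.induce _).toHom
    exact (measureReal_mono hsub).trans (measureReal_union_le _ _)
  refine Summable.of_nonneg_of_le (fun x => measureReal_nonneg) hle (hsum.add hB)

/-- **S ⟹ (B) (PROVED)**: under `θ(p_c) = 0` every term of (B) vanishes. [folklore] -/
theorem halfSpacePieceSummable_of_summit (h : _root_.PercolationContinuityZ3) : HalfSpacePieceSummable := by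
  have hθ0 : theta (zdGraph 3) (0 : Site 3) (criticalProbI 3) = 0 := h
  have hnull : Pc (percolatesAt (0 : Site 3)) = 0 := by
    unfold theta at hθ0
    exact (measureReal_eq_zero_iff (measure_ne_top _ _)).1 hθ0
  have hzero : ∀ x : Site 3, Pc.real (openConnIn (halfSpace 3) (0 : Site 3) x ∩ percolatesAt (0 : Site 3)) = 0 := by
    intro x
    rw [measureReal_def, measure_inter_null_of_null_right _ hnull, ENNReal.toReal_zero]
  have hfun : (fun x : Site 3 =>
      Pc.real (openConnIn (halfSpace 3) (0 : Site 3) x ∩ percolatesAt (0 : Site 3))) = fun _ => 0 :=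
    funext hzero
  unfold HalfSpacePieceSummable
  rw [hfun]
  exact summable_zero

/-- **(B) ⟹ S by MASS TRANSPORT** (stated; provable, M/L-sized): if `θ(p_c) > 0` then
`E_{p_c}[|C_ℍ(0)|; 0 ↔ ∞] = ∞`. Transport on the horizontal group `ℤ²`: every `x ∈ ℍ` with `x ↔ ∞` sends unit mass,
split equally, to the boundary vertices of its (a.s. finite, BGN at every depth by finite energy) ℍ-cluster — nonempty
because the infinite path from `x` must exit ℍ through `∂ℍ`. Mass sent from the column above `0`: `Σ_{h≥0} θ(p_c) = ∞`;
mass received at `0`: `E[|C_ℍ(0)|/|C_ℍ(0) ∩ ∂ℍ| ; 0 ↔ ∞] ≤ E[|C_ℍ(0)|; 0 ↔ ∞]`. Hence (B) fails in every jump world: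
the separating piece of the half-space transfer is summit-strength. [≡ summit; cite: LyonsPeres2016, §8.1 (mass-transport principle); BenjaminiLyonsPeresSchramm1999] -/
def HalfSpacePieceMTP : Prop :=
  0 < theta (zdGraph 3) (0 : Site 3) (criticalProbI 3) → ¬ HalfSpacePieceSummable

/-- The dichotomy packaged: given the MTP step, (B) is literally equivalent to the conjunct. [folklore] -/
theorem halfSpacePieceSummable_iff_summit (hMTP : HalfSpacePieceMTP) :
    HalfSpacePieceSummable ↔ _root_.PercolationContinuityZ3 := by
  refine ⟨fun hB => ?_, halfSpacePieceSummable_of_summit⟩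
  by_contra hS
  have hne : theta (zdGraph 3) (0 : Site 3) (criticalProbI 3) ≠ 0 := hS
  have hpos : 0 < theta (zdGraph 3) (0 : Site 3) (criticalProbI 3) :=
    lt_of_le_of_ne (by unfold theta; exact measureReal_nonneg) (Ne.symm hne)
  exact hMTP hpos hB

/-! ## N3 — the quantitative contrapositive of line `necklace` -/

/-- **Bridge-count bound in the ¬H world** (stated; provable now, M-sized): if `τ^f_{p_c}` is summable then the expected
number of BRIDGES of `C(0)` above the origin on `{0 ↔ ∞}` — open edges `e` whose closure disconnects `0` from `∞` — is
at most `(6 p_c/(1 − p_c)) · Σ_x τ^f_{p_c}(0,x)`. Proof route: for a fixed edge `e = {y, y'}` the map `ω ↦ ω ∖ e` is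
injective on `{e bridge, 0 on the finite side}` with image in `{e closed, |C(0)| < ∞, e touches C(0)}` and costs
`p_c/(1 − p_c)` (deletion tolerance, `DeletionTolerance.lean`); summing over `e` and counting `#{e touching C(0)} ≤ 6|C(0)|`
gives the bound (the same inequality as `necklaceFatTails_proof`, read backwards). Consequence: in W₀ a.s. finitely many
bridges above every percolating vertex, so beyond the last one the cluster is 2-edge-connected to infinity — ¬NoBackbone
with an explicit constant. [folklore; cite: BurtonKeane1989 (deletion tolerance); ChayesChayes1986 Thm 4.1(b)] -/
def BridgeCountBound : Prop :=
  Summable (fun x : Site 3 => Pc.real (openConn (0 : Site 3) x \ percolatesAt (0 : Site 3))) →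
    ∫⁻ ω in percolatesAt (0 : Site 3),
        (({e : Sym2 (Site 3) | e ∈ ω ∧ ω \ {e} ∉ percolatesAt (0 : Site 3)}).encard : ℝ≥0∞) ∂Pc ≤
      ENNReal.ofReal (6 * (criticalProbI 3 : ℝ) / (1 - (criticalProbI 3 : ℝ)) *
        ∑' x : Site 3, Pc.real (openConn (0 : Site 3) x \ percolatesAt (0 : Site 3)))

end Summit.CriticalPhenomena.PercolationContinuityZ3.Cruxes.CritTruncatedSusceptibilityInfinite.StrategistR1

end
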